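import Summits.FinalStateConjecture.FinalStateConjecture.Theorems.SwallowTheDatumKerrShieldedDataExistOfExactPocket
import Summits.FinalStateConjecture.FinalStateConjecture.Theorems.SwallowTheDatumKerrShieldedDataExistExactPocketOfLiMei
import HarnessLib

/-!
# Route SwallowTheDatum — crux `KerrShieldedDataExist` (stmt-FinalStateConjecture-10055) from the two published
# Li–Mei theorems (line `plug-the-second-sheet` v4 = "KerrCap")

Lead prover-line-stmt-FinalStateConjecture-10055-c1-0, 2026-08-16. The crux
`Summit.FinalStateConjecture.FinalStateConjecture.Theses.SwallowTheDatum.KerrShieldedDataExist` — ONE admissible vacuum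
datum on `E3` which, outside a compact set, IS the hard-coded bent Kerr–Schild/Boyer–Lindquist leaf `t* = T_{M,a}(r)` of a
sub-extremal Kerr(`M, a`) down to a junction radius `r₁ ∈ (r₋, r₊)` — is PROVED MODULO exactly two published theorems of
J. Li, H. Mei, *A construction of collapsing spacetimes in vacuum*, Comm. Math. Phys. 378 (2020) = arXiv:2005.01249,
taken as named facts (D-0014):

* `LiMei.nearSchwarzschildPocket` (`Literature/Geometry/Lorentzian/LiMeiCollapsePocket.lean`) — Thm 2.1 + §2.2: the
  near-Schwarzschild vacuum pocket (Christodoulou short-pulse interior bounded by the spacelike cylinder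
  `{r = r₀ < 2m₀}` inside the black hole);
* `LiMei.interiorKerrGluing` (`Literature/Geometry/Lorentzian/InteriorKerrGluing.lean`) — Prop 4.1 = Thm 2.2: the
  Corvino–Schoen interior gluing on that cylinder to EXACT Kerr(`m, a⃗`)-cylinder data.

`kerrShieldedDataExist_of_liMei` composes `exactPocket_of_liMei` (`…ExactPocketOfLiMei.lean`: vacuum on the whole ball
by locality; spin axis rotated into standard position by `comap`) with `kerrShieldedDataExist_of_exactPocket`
(`…OfExactPocket.lean`: the explicit Kerr capping — profiles, cap map, gluing, shielding block, Dafermos–Rodnianski end —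
all theorems of the tree for every sub-extremal spin). No Einstein evolution is used anywhere; the trust base of the
crux is {the two facts above} ∪ `[Kerr.Facts]` (connectedness/analyticity of the Kerr–Schild chart, in the statement).
-/

set_option linter.dupNamespace false

noncomputable section

open Literature.Geometry.Lorentzian

namespace Summit.FinalStateConjecture.FinalStateConjecture.Theorems.SwallowTheDatum

/-- **`KerrShieldedDataExist` from Li–Mei 2020, Thm 2.1 + §2.2 and Prop 4.1** (the two named facts
`LiMei.nearSchwarzschildPocket`, `LiMei.interiorKerrGluing`): the reshaped line `plug-the-second-sheet` v4 of crux
stmt-FinalStateConjecture-10055, CLOSED MODULO these two published theorems. [cite: LiMei2020, Thm 2.1, §2.2, Prop 4.1] -/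
theorem kerrShieldedDataExist_of_liMei :
    Literature.Geometry.Lorentzian.LiMei.nearSchwarzschildPocket →
    Literature.Geometry.Lorentzian.LiMei.interiorKerrGluing →
    Summit.FinalStateConjecture.FinalStateConjecture.Theses.SwallowTheDatum.KerrShieldedDataExist :=
  fun hP hG ↦ kerrShieldedDataExist_of_exactPocket (exactPocket_of_liMei hP hG)

end Summit.FinalStateConjecture.FinalStateConjecture.Theorems.SwallowTheDatum

end
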